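import Summits.QuantumAdvantage.QuantumAdvantage.Theorems.NearExactIsExact.Negative.NoCaseAMM59
import Summits.QuantumAdvantage.QuantumAdvantage.Theorems.NearExactIsExact.Negative.SkewProductCore

/-!
# `NearExactIsExact` (stmt-QuantumAdvantage-14043) — fibre-parity dichotomy for quadratic maps `𝔽₂⁹ → 𝔽₂⁵`

B2b disprover cell (gen 27), a rider to THEOREM MM59-W (`Negative.TypeOMM59WindowFourteen`).
HONEST FRAMING: a small kernel-checked structural fact about quadratic fibrations, NOT summit progress.

For a quadratic `φ = (q₀,…,q₄) : 𝔽₂⁹ → 𝔽₂⁵` ALL 32 fibres `A_a = φ⁻¹(a)` have the SAME parity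
(`natCast_card_fib_eq`, `fib_parity_dichotomy`): `A_a ∪ A_{a ⊕ e_i}` is cut out by the four quadratic
equations `q_k = a_k (k ≠ i)`, whose indicator has degree `≤ 8 < 9` and hence even weight
(`natCast_card_fib_add_update`). Consequently (`fs_parity_dichotomy`) the signed fibre sums
`f_a(b) = Σ_{A_a} ε_y (-1)^{b·y}` (`ε` odd, e.g. `ε = (-1)^h`) — i.e. `W_g/32` for the Maiorana–McFarland
function `g(x‖y) = x·φ(y) ⊕ h(y)` on `5 + 9` bits (`MM59.W_signForm`) — are either ALL ODD ("type O": then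
`Φ(f,g) ≤ 59/64` for every `f`, THEOREM MM59-W) or ALL EVEN (`W_g ∈ 64ℤ`, the level-`≥ 6` branch of the
`n = 14` tower, where capacity arguments are void and the cubic-partner constraint must be used).
Sources: [this work]; Chevalley–Warning-type parity `deg < m ⇒ even support` [folklore]
(`CentroidMoments.natCast_card_eq_zero_of_isDegLeFun`). Standard axioms only.
-/

set_option linter.dupNamespace false -- D-0017: single-problem summit ⇒ `QuantumAdvantage.QuantumAdvantage` by design

namespace Summit.QuantumAdvantage.QuantumAdvantage.Theorems.NearExactIsExact.Negative.FibreParityMM59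

open Finset
open Literature.Computability.QuantumComplexity
open Summit.QuantumAdvantage.QuantumAdvantage.Theorems.NearExactIsExact.Negative.CentroidMoments
open Summit.QuantumAdvantage.QuantumAdvantage.Theorems.NearExactIsExact.Negative.SkewProductCore
  (ind supp prod_ind_eq isDegLeFun_prod)
open Summit.QuantumAdvantage.QuantumAdvantage.Theorems.NearExactIsExact.Negative.MM59

variable {q : Fin 5 → (Fin 9 → Bool) → Bool}

/-- `#A_a + #A_{a ⊕ e_i}` is even: the union is `{y : q_k(y) = a_k ∀ k ≠ i}`, of degree `≤ 8 < 9`. [this work] -/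
theorem natCast_card_fib_add_update (hq : ∀ i, IsDegLeFun 2 (q i)) (a : Fin 5 → Bool) (i : Fin 5) :
    ((#(fib q a) + #(fib q (Function.update a i (!a i))) : ℕ) : ZMod 2) = 0 := by
  set c : Fin 5 → (Fin 9 → Bool) → Bool := fun k y => (q k y == a k) with hc
  have hcdeg : ∀ k, IsDegLeFun 2 (c k) := by
    intro k
    cases hak : a k
    · have e : c k = fun y => !q k y := by funext y; simp [hc, hak]
      rw [e]; exact isDegLeFun_not (hq k)
    · have e : c k = q k := by funext y; simp [hc, hak]
      rw [e]; exact hq k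
  set G : (Fin 9 → Bool) → Bool := fun y => decide ((∏ k ∈ univ.erase i, ind (c k y)) = 1) with hG
  have hK : #(univ.erase i : Finset (Fin 5)) = 4 := by
    rw [card_erase_of_mem (mem_univ i), card_univ, Fintype.card_fin]
  have hGdeg : IsDegLeFun 8 G :=
    (isDegLeFun_prod c (univ.erase i) (fun k _ => hcdeg k)).mono (by omega)
  have hGeven := natCast_card_eq_zero_of_isDegLeFun hGdeg (by norm_num)
  have hGiff : ∀ y, G y = true ↔ ∀ k, k ≠ i → q k y = a k := by
    intro y
    rw [hG]
    simp only [decide_eq_true_eq, prod_ind_eq]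
    have e : univ.erase i ⊆ supp (fun k => c k y) ↔ ∀ k, k ≠ i → q k y = a k := by
      simp [supp, subset_iff, hc]
    rw [← e]
    by_cases h : univ.erase i ⊆ supp (fun k => c k y)
    · rw [if_pos h]; exact ⟨fun _ => h, fun _ => rfl⟩
    · rw [if_neg h]; exact ⟨fun h' => absurd h' zero_ne_one, fun h' => absurd h' h⟩
  have hunion : ({y : Fin 9 → Bool | G y} : Finset (Fin 9 → Bool)) =
      fib q a ∪ fib q (Function.update a i (!a i)) := by
    ext y
    simp only [mem_filter, mem_univ, true_and, mem_union, mem_fib]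
    rw [hGiff y]
    constructor
    · intro h
      by_cases hqi : q i y = a i
      · left
        intro k
        by_cases hk : k = i
        · subst hk; exact hqi
        · exact h k hk
      · right
        intro k
        by_cases hk : k = i
        · subst hk
          rw [Function.update_self]
          revert hqi
          cases q k y <;> cases a k <;> decide
        · rw [Function.update_of_ne hk]; exact h k hk
    · rintro (h | h) k hk
      · exact h k
      · rw [h k, Function.update_of_ne hk]
  have hdisj : Disjoint (fib q a) (fib q (Function.update a i (!a i))) := by
    rw [disjoint_left]
    intro y h1 h2
    have e1 : q i y = a i := (mem_fib.mp h1) i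
    have e2 : q i y = !a i := by simpa using (mem_fib.mp h2) i
    rw [e1] at e2
    revert e2
    cases a i <;> decide
  rw [hunion, card_union_of_disjoint hdisj] at hGeven
  exact hGeven

/-- All fibres of a quadratic `φ : 𝔽₂⁹ → 𝔽₂⁵` have the same parity. [this work] -/
theorem natCast_card_fib_eq (hq : ∀ i, IsDegLeFun 2 (q i)) (a a' : Fin 5 → Bool) :
    ((#(fib q a) : ℕ) : ZMod 2) = ((#(fib q a') : ℕ) : ZMod 2) := by
  -- reduce both to the fibre over `0` by induction on the number of `true` coordinates
  suffices h : ∀ (n : ℕ) (a : Fin 5 → Bool), #(supp a) = n →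
      ((#(fib q a) : ℕ) : ZMod 2) = ((#(fib q (fun _ => false)) : ℕ) : ZMod 2) by
    rw [h _ a rfl, h _ a' rfl]
  intro n
  induction n with
  | zero =>
    intro a ha
    have e : a = fun _ => false := by
      funext k
      by_contra hk
      have hmem : k ∈ supp a := by
        simp only [supp, mem_filter, mem_univ, true_and]
        revert hk; cases a k <;> decide
      rw [card_eq_zero.mp ha] at hmem
      exact absurd hmem (by simp)
    rw [e]
  | succ n ih =>
    intro a ha
    obtain ⟨i, hi⟩ : (supp a).Nonempty := card_pos.mp (by omega)
    have hai : a i = true := by simpa [supp] using hi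
    have hstep := natCast_card_fib_add_update hq a i
    rw [hai, Bool.not_true] at hstep
    have hsupp : supp (Function.update a i false) = (supp a).erase i := by
      ext k
      by_cases hk : k = i
      · subst hk; simp [supp]
      · simp [supp, hk]
    have hcard : #(supp (Function.update a i false)) = n := by
      rw [hsupp, card_erase_of_mem hi, ha]; rfl
    rw [← ih _ hcard]
    push_cast at hstep
    rw [eq_neg_of_add_eq_zero_left hstep, ZMod.neg_eq_self_mod_two]

/-- **Fibre-parity dichotomy**: a quadratic `φ : 𝔽₂⁹ → 𝔽₂⁵` has either all fibres odd or all fibres even.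
[this work] -/
theorem fib_parity_dichotomy (hq : ∀ i, IsDegLeFun 2 (q i)) :
    (∀ a, Odd #(fib q a)) ∨ (∀ a, Even #(fib q a)) := by
  by_cases h0 : Odd #(fib q (fun _ => false))
  · left
    intro a
    have h := (ZMod.natCast_eq_natCast_iff' _ _ 2).mp (natCast_card_fib_eq hq a (fun _ => false))
    rw [Nat.odd_iff] at h0 ⊢
    omega
  · right
    intro a
    have h := (ZMod.natCast_eq_natCast_iff' _ _ 2).mp (natCast_card_fib_eq hq a (fun _ => false))
    rw [Nat.not_odd_iff_even, Nat.even_iff] at h0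
    rw [Nat.even_iff]
    omega

/-- `(-1)^{b·y} ≡ 1 (mod 2)`. [folklore] -/
theorem intCast_zt (b y : Fin 9 → Bool) : ((zt b y : ℤ) : ZMod 2) = 1 := by
  unfold zt
  push_cast
  exact prod_eq_one fun j _ => by split_ifs <;> decide

/-- `f_a(b) ≡ #A_a (mod 2)` for odd weights `ε`. [folklore] -/
theorem intCast_fs {ε : (Fin 9 → Bool) → ℤ} (hε : ∀ y, Odd (ε y)) (a : Fin 5 → Bool) (b : Fin 9 → Bool) :
    ((fs q ε a b : ℤ) : ZMod 2) = ((#(fib q a) : ℕ) : ZMod 2) := by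
  rw [← intCast_sum_odd (fib q a) ε hε]
  unfold fs
  push_cast
  exact sum_congr rfl fun y _ => by rw [intCast_zt, mul_one]

/-- **Signed form of the dichotomy**: for a quadratic `φ` and odd `ε`, the fibre sums `f_a(b)` (`= W_g/32` for
`g = x·φ(y) ⊕ h(y)`, `ε = (-1)^h`, by `MM59.W_signForm`) are ALL ODD (type O) or ALL EVEN (`W_g ∈ 64ℤ`).
[this work] -/
theorem fs_parity_dichotomy (hq : ∀ i, IsDegLeFun 2 (q i)) {ε : (Fin 9 → Bool) → ℤ} (hε : ∀ y, Odd (ε y)) :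
    (∀ a b, Odd (fs q ε a b)) ∨ (∀ a b, Even (fs q ε a b)) := by
  rcases fib_parity_dichotomy hq with h | h
  · left
    intro a b
    have e := intCast_fs (q := q) hε a b
    rw [(h a).natCast_zmod_two] at e
    exact ZMod.intCast_eq_one_iff_odd.mp e
  · right
    intro a b
    have e := intCast_fs (q := q) hε a b
    rw [(h a).natCast_zmod_two] at e
    exact ZMod.intCast_eq_zero_iff_even.mp e

end Summit.QuantumAdvantage.QuantumAdvantage.Theorems.NearExactIsExact.Negative.FibreParityMM59
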